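import Literature.Analysis.FluidPDE.ChaeAsymptoticallySelfSimilarProfileThree
import Literature.Analysis.FluidPDE.RescaleDataLpContinuity
import Literature.Analysis.FluidPDE.VeryWeakLqMild
import Literature.Analysis.FluidPDE.LpMildKatoClassical
import HarnessLib

/-!
# Chae 2007, Theorem 1.5: the profile conclusion `V̄ = 0` for `3 < p < ∞` (proofs companion, part 8)

Analysis/FluidPDE proofs file (theorems only: no definitions, no named facts), eighth companion
of `Literature/Analysis/FluidPDE/ChaeAsymptoticallySelfSimilar.lean` (D. Chae, Math. Ann. 338
(2007) 435–449 = arXiv:math/0604234, **Theorem 1.5**, the named fact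
`chae2007_asymptoticallySelfSimilar_local`). The seventh companion proved the profile conclusion
`V̄ = 0` for `p = 3` and reduced the fact to two inputs, the regularity of very weak Leray profiles
in `L^p` for `p > 3` (`h₁`) and a suitable representative up to the blow-up time (`h₂`). This file
PROVES `V̄ = 0` for every `3 ≤ p < ∞` with no regularity input — in print "`V̄ ∈ L^p` is a weak
solution of the Leray system, hence `V̄ = 0` by [NRŠ] (`p = 3`) / [Tsai] (`p > 3`)" (arXiv p. 8),
the regularity of the weak profile being implicit — and so reduces the fact to `h₂` alone
(`chae2007_asymptoticallySelfSimilar_local_of_suitableRepresentative`).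

The subcritical route (`3 < p < ∞`), parallel to the critical one of part 7: the shifted blow-up
limit `w(s) = u_V̄(s − 1)` on the slab `(0, 1) × ℝ³` is a very weak solution of Navier–Stokes
(second companion) with slices in `L^p`, bounded on `(0, ½)` and continuous in `L^p` (dilations act
continuously on `L^p`, `RescaleDataLpContinuity.lean`), hence a mild solution between any two
times (`VeryWeakLqMild.isMildNSSolutionBetween_of_veryWeak`: Fabes–Jones–Rivière with NO pressure),
hence classical on some later time interval by Kato's `L^p` theory
(`LpMildKato.exists_classical_representative`: identification with the Oseen representative,
comparison with Kato's fixed point, KNSS smoothing), and the classical representative of a backward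
self-similar field is Leray's field of a smooth profile in `L^p`, which vanishes by Tsai's theorem
(`profile_ae_eq_zero_of_classical_representative'`).

* `memLp_uncurry_lerayBackward_shift_Lp` — the shifted backward field is in `L^p` of the slabs
  `(0, S) × ℝ³`, `S < 1`;
* `integral_veryWeakIntegrand_shift_eq_zero` — the very weak identity on the slab `(0, S)` in the
  product form;
* `isMildNSSolutionBetween_shift` — the shifted field is a mild solution between all
  `0 < s ≤ t < ½`;
* `chae2007_profile_ae_eq_zero_gt_three`, **`chae2007_profile_ae_eq_zero`** — `V̄ = 0` for
  `3 < p < ∞`, and for all `3 ≤ p < ∞`;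
* **`chae2007_asymptoticallySelfSimilar_local_of_suitableRepresentative`** — the fact from `h₂`
  alone.

## References

* D. Chae, Math. Ann. 338 (2007) = arXiv:math/0604234, proof of Thm 1.5 (arXiv p. 8) [Chae2007].
* T. Kato, Math. Z. 187 (1984), Thm. 1 [Kato1984].
* E. B. Fabes, B. F. Jones, N. M. Rivière, Arch. Rational Mech. Anal. 45 (1972), Thm. 2.1
  [FabesJonesRiviere1972].
* T.-P. Tsai, Arch. Rational Mech. Anal. 143 (1998), Thm 1 [Tsai1998].
-/

noncomputable section

open _root_.MeasureTheory Set Function Filter Metric TopologicalSpace InnerProductSpace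
open scoped NNReal ENNReal _root_.Topology RealInnerProductSpace Laplacian ContDiff

namespace Literature.Analysis.FluidPDE

/-- Local notation for physical space `ℝ³ = EuclideanSpace ℝ (Fin 3)`. -/
local notation "ℝ³" => EuclideanSpace ℝ (Fin 3)

/-! ### The shifted backward field on the slabs `(0, S) × ℝ³`, `S < 1`, in `L^p` -/

section Slab

variable {p : ℝ≥0} {V : ℝ³ → ℝ³}

/-- **The shifted backward field lies in `L^p` of every slab `(0, S) × ℝ³`, `0 ≤ S < 1`**, for
`V ∈ L^p` strongly measurable, `1 ≤ p` (its slices have `‖u_V(s−1)‖_{L^p} ≤ (√(1−S))⁻¹‖V‖_{L^p}`,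
`eLpNorm_lerayBackward_shift_le_Lp`). [folklore] -/
theorem memLp_uncurry_lerayBackward_shift_Lp (hp1 : 1 ≤ p) (hV : MemLp V (p : ℝ≥0∞) volume)
    (hVm : StronglyMeasurable V) {S : ℝ} (hS1 : S < 1) :
    MemLp (uncurry fun s x => lerayBackward (1 / 2) 0 V (s - 1) x) (p : ℝ≥0∞)
      (volume.restrict (Ioo 0 S ×ˢ (univ : Set ℝ³))) := by
  have hp0 : (p : ℝ≥0∞) ≠ 0 := by
    have : (0 : ℝ≥0) < p := lt_of_lt_of_le zero_lt_one hp1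
    exact_mod_cast this.ne'
  have hptop : (p : ℝ≥0∞) ≠ ⊤ := ENNReal.coe_ne_top
  have hr0 : 0 < (p : ℝ≥0∞).toReal := ENNReal.toReal_pos hp0 hptop
  have hsm := stronglyMeasurable_uncurry_lerayBackward_shift hVm
  refine ⟨hsm.aestronglyMeasurable, ?_⟩
  rw [eLpNorm_eq_lintegral_rpow_enorm_toReal hp0 hptop]
  refine ENNReal.rpow_lt_top_of_nonneg (by positivity) (ne_of_lt ?_)
  have hmeas : AEMeasurable (fun z : ℝ × ℝ³ =>
      ‖uncurry (fun s x => lerayBackward (1 / 2) 0 V (s - 1) x) z‖ₑ ^ (p : ℝ≥0∞).toReal)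
      ((volume.restrict (Ioo 0 S)).prod (volume : Measure ℝ³)) :=
    (hsm.measurable.enorm.pow_const _).aemeasurable
  set B : ℝ≥0∞ := ENNReal.ofReal (Real.sqrt (1 - S))⁻¹ * eLpNorm V p volume with hB
  have hBtop : B ≠ ⊤ := ENNReal.mul_ne_top ENNReal.ofReal_ne_top hV.2.ne
  rw [volume_restrict_prod_univ_eq_prod, lintegral_prod _ hmeas]
  calc ∫⁻ s in Ioo 0 S, ∫⁻ x, ‖uncurry (fun s x => lerayBackward (1 / 2) 0 V (s - 1) x) (s, x)‖ₑ ^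
        (p : ℝ≥0∞).toReal
      ≤ ∫⁻ _ in Ioo 0 S, B ^ (p : ℝ≥0∞).toReal := by
        refine lintegral_mono_ae ?_
        filter_upwards [ae_restrict_mem measurableSet_Ioo] with s hs
        have e := eLpNorm_eq_lintegral_rpow_enorm_toReal (f := lerayBackward (1 / 2) 0 V (s - 1))
          (p := (p : ℝ≥0∞)) (μ := volume) hp0 hptop
        have h1 : (∫⁻ x, ‖lerayBackward (1 / 2) 0 V (s - 1) x‖ₑ ^ (p : ℝ≥0∞).toReal) =
            eLpNorm (lerayBackward (1 / 2) 0 V (s - 1)) p volume ^ (p : ℝ≥0∞).toReal := by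
          rw [e, ← ENNReal.rpow_mul, one_div (p : ℝ≥0∞).toReal, inv_mul_cancel₀ hr0.ne',
            ENNReal.rpow_one]
        change (∫⁻ x, ‖lerayBackward (1 / 2) 0 V (s - 1) x‖ₑ ^ (p : ℝ≥0∞).toReal) ≤ B ^ (p : ℝ≥0∞).toReal
        rw [h1]
        exact ENNReal.rpow_le_rpow (eLpNorm_lerayBackward_shift_le_Lp p V hS1 hs.1.le hs.2.le) hr0.le
    _ < ⊤ := by
        rw [lintegral_const, Measure.restrict_apply_univ, Real.volume_Ioo]
        exact ENNReal.mul_lt_top (ENNReal.rpow_lt_top_of_nonneg hr0.le hBtop) ENNReal.ofReal_lt_top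

end Slab

/-! ### The very weak identity and the mild identity for the shifted field, `L^p` version -/

section Chain

variable {T : ℝ} {z : ℝ³} {q p : ℝ≥0} {v : ℝ → ℝ³ → ℝ³} {π : ℝ → ℝ³ → ℝ} {V : ℝ³ → ℝ³}

/-- **The very weak identity of the shifted blow-up limit on a slab `(0, S)`, `S < 1`, in the
product form** (the iterated identity of the seventh companion on `(0, 1)`, restricted to the time
support of the test field and converted by Fubini, `setIntegral_veryWeak_eq_zero_of_iterated`), for
`V ∈ L^p`, `2 ≤ p`. [cite: Chae2007, proof of Thm 1.5 (arXiv p. 8)] -/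
theorem integral_veryWeakIntegrand_shift_eq_zero (hT : 0 < T)
    (hv : IsClassicalNSSolutionOn (Ioo 0 T) 1 0 v π) (hp2 : 2 ≤ p) (hV : MemLp V (p : ℝ≥0∞) volume)
    (hVm : StronglyMeasurable V) (hq : 2 ≤ q)
    (hdev : ∀ R : ℝ, 0 < R → Tendsto (chaeLocalDeviation T z q R v V) (𝓝[<] T) (𝓝 0))
    {S : ℝ} (hS : 0 < S) (hS1 : S < 1) {ψ : ℝ → ℝ³ → ℝ³}
    (hψ : IsSpaceTimeTestOn (slab ℝ³ (Ioo 0 S) isOpen_Ioo) ψ) (hdivψ : ∀ t, VectorCalculus.IsDivFree (ψ t)) :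
    ∫ ζ in Ioo 0 S ×ˢ (univ : Set ℝ³),
      veryWeakIntegrand 1 (fun s => lerayBackward (1 / 2) 0 V (s - 1)) ψ ζ = 0 := by
  set w : ℝ → ℝ³ → ℝ³ := fun s => lerayBackward (1 / 2) 0 V (s - 1) with hw
  have hp1 : 1 ≤ p := le_trans (by norm_num) hp2
  have hup : MemLp (uncurry w) (p : ℝ≥0∞) (volume.restrict (Ioo 0 S ×ˢ (univ : Set ℝ³))) :=
    memLp_uncurry_lerayBackward_shift_Lp hp1 hV hVm hS1
  have h1p : (1 : ℝ≥0∞) ≤ (p : ℝ≥0∞) := by exact_mod_cast hp1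
  have hu1 : LocallyIntegrableOn (uncurry w)
      ((slab ℝ³ (Ioo 0 S) isOpen_Ioo : Opens (ℝ × ℝ³)) : Set (ℝ × ℝ³)) volume :=
    locallyIntegrableOn_slab_of_memLp hup h1p
  have hu2 : LocallyIntegrableOn (fun ζ => ‖uncurry w ζ‖ ^ 2)
      ((slab ℝ³ (Ioo 0 S) isOpen_Ioo : Opens (ℝ × ℝ³)) : Set (ℝ × ℝ³)) volume := by
    have h := hup.norm_rpow_div (2 : ℝ≥0∞)
    have h' : MemLp (fun ζ => ‖uncurry w ζ‖ ^ 2) ((p : ℝ≥0∞) / 2)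
        (volume.restrict (Ioo 0 S ×ˢ (univ : Set ℝ³))) := by
      refine h.congr_norm (hup.1.norm.pow 2) (Eventually.of_forall fun ζ => ?_)
      simp only [ENNReal.toReal_ofNat, Real.rpow_two, norm_pow, norm_norm]
    refine locallyIntegrableOn_slab_of_memLp h' ?_
    rw [ENNReal.le_div_iff_mul_le (Or.inl two_ne_zero) (Or.inl ENNReal.ofNat_ne_top), one_mul]
    exact_mod_cast hp2
  change ∫ ζ in Ioo 0 S ×ˢ (univ : Set ℝ³), veryWeakIntegrand 1 w ψ ζ = 0
  have key0 : ∫ ζ in Ioo 0 S ×ˢ (univ : Set ℝ³), (⟪w ζ.1 ζ.2, timeDeriv ψ ζ.1 ζ.2⟫ +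
      ⟪w ζ.1 ζ.2, convect (w ζ.1) (ψ ζ.1) ζ.2⟫ + 1 * ⟪w ζ.1 ζ.2, Δ (ψ ζ.1) ζ.2⟫) = 0 := by
    refine setIntegral_veryWeak_eq_zero_of_iterated hu1 hu2 hψ ?_
    -- the iterated identity on `(0, 1)` restricts to `(0, S)`: the integrand has time support there
    have hψ1 : IsSpaceTimeTestOn (slab ℝ³ (Ioo 0 1) isOpen_Ioo) ψ :=
      hψ.mono (slab_mono (Ioo_subset_Ioo le_rfl hS1.le))
    have key := integral_veryWeak_shift_eq_zero hT hv hV.1 hq hdev hψ1 hdivψ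
    obtain ⟨a, b, h0a, hab, hbS, hsupp⟩ := hψ.exists_time_support_Ioo hS
    set J : ℝ → ℝ := fun s => ∫ x, (⟪w s x, timeDeriv ψ s x⟫ + ⟪w s x, convect (w s) (ψ s) x⟫ +
      1 * ⟪w s x, Δ (ψ s) x⟫) with hJ
    have hψ0 : ∀ t, t ∉ Icc a b → ∀ x, ψ t x = 0 := fun t ht x => by rw [hsupp t ht]; rfl
    have hJ0 : ∀ t, t ∉ Icc a b → J t = 0 := by
      intro t ht
      refine integral_eq_zero_of_ae (Eventually.of_forall fun x => ?_)
      have hopen : IsOpen (Icc a b)ᶜ := isClosed_Icc.isOpen_compl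
      have hnear : (fun s => ψ s x) =ᶠ[𝓝 t] fun _ => (0 : ℝ³) :=
        Filter.eventually_of_mem (hopen.mem_nhds ht) fun s hs => hψ0 s hs x
      have h1 : timeDeriv ψ t x = 0 := by
        rw [timeDeriv_apply, hnear.deriv_eq, deriv_const]
      have h2 : fderiv ℝ (ψ t) x = 0 := by
        rw [show ψ t = fun _ => (0 : ℝ³) from funext (hψ0 t ht), fderiv_fun_const, Pi.zero_apply]
      have h3 : Δ (ψ t) x = 0 :=
        laplacian_eq_zero_of_notMem_tsupport (by
          rw [hsupp t ht, tsupport_eq_empty_iff.2 rfl]; exact notMem_empty x)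
      dsimp only
      rw [Pi.zero_apply, h1, convect_apply, h2, h3]
      simp
    have eS : ∫ s in Ioo (0 : ℝ) S, J s = ∫ s, J s :=
      setIntegral_eq_integral_of_forall_compl_eq_zero fun t ht =>
        hJ0 t fun h => ht ⟨h0a.trans_le h.1, h.2.trans_lt hbS⟩
    have e1 : ∫ s in Ioo (0 : ℝ) 1, J s = ∫ s, J s :=
      setIntegral_eq_integral_of_forall_compl_eq_zero fun t ht =>
        hJ0 t fun h => ht ⟨h0a.trans_le h.1, (h.2.trans_lt hbS).trans hS1⟩
    change ∫ s in Ioo (0 : ℝ) S, J s = 0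
    rw [eS, ← e1]
    exact key
  refine Eq.trans (integral_congr_ae (Eventually.of_forall fun ζ => ?_)) key0
  rw [veryWeakIntegrand_apply]

/-- **The shifted blow-up limit is a mild solution between all times `0 < s ≤ t < ½`** for
`V̄ ∈ L^p` strongly measurable, `2 < p` (very weak + `C_t L^p` + bounded + weakly divergence-free
slices ⇒ mild, `VeryWeakLqMild.isMildNSSolutionBetween_of_veryWeak`, with no pressure).
[cite: Chae2007, proof of Thm 1.5 (arXiv p. 8); FabesJonesRiviere1972, Thm. 2.1] -/
theorem isMildNSSolutionBetween_shift (hT : 0 < T)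
    (hv : IsClassicalNSSolutionOn (Ioo 0 T) 1 0 v π) (hp2 : 2 < p) (hV : MemLp V (p : ℝ≥0∞) volume)
    (hVm : StronglyMeasurable V) (hq : 2 ≤ q)
    (hdev : ∀ R : ℝ, 0 < R → Tendsto (chaeLocalDeviation T z q R v V) (𝓝[<] T) (𝓝 0))
    {s t : ℝ} (hs : 0 < s) (hst : s ≤ t) (ht : t < 1 / 2) :
    IsMildNSSolutionBetween 1 0 (fun σ => lerayBackward (1 / 2) 0 V (σ - 1)) s t := by
  set w : ℝ → ℝ³ → ℝ³ := fun σ => lerayBackward (1 / 2) 0 V (σ - 1) with hw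
  have hS : (0 : ℝ) < 1 / 2 := by norm_num
  have hS1 : (1 / 2 : ℝ) < 1 := by norm_num
  have hp1 : (1 : ℝ≥0) ≤ p := le_trans (by norm_num) hp2.le
  have hpr : (p : ℝ≥0∞) = ENNReal.ofReal (p : ℝ) := (ENNReal.ofReal_coe_nnreal).symm
  have hr2 : (2 : ℝ) < (p : ℝ) := by exact_mod_cast hp2
  -- measurability on the slab
  have hum : AEStronglyMeasurable (uncurry w) (volume.restrict (Ioo 0 (1 / 2) ×ˢ (univ : Set ℝ³))) :=
    (stronglyMeasurable_uncurry_lerayBackward_shift hVm).aestronglyMeasurable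
  -- continuity in `L^p`
  have huc : ContinuousInLpOn (Ioo 0 (1 / 2)) (ENNReal.ofReal (p : ℝ)) w := by
    rw [← hpr]
    exact continuousInLpOn_lerayBackward_shift_Lp (by exact_mod_cast hp1) ENNReal.coe_ne_top hV
      fun σ hσ => hσ.2.trans hS1
  -- the bound
  set M : ℝ≥0 := (ENNReal.ofReal (Real.sqrt (1 - 1 / 2))⁻¹ * eLpNorm V p volume).toNNReal with hM
  have hMeq : (M : ℝ≥0∞) = ENNReal.ofReal (Real.sqrt (1 - 1 / 2))⁻¹ * eLpNorm V p volume :=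
    ENNReal.coe_toNNReal (ENNReal.mul_ne_top ENNReal.ofReal_ne_top hV.2.ne)
  have huM : ∀ τ ∈ Ioo (0 : ℝ) (1 / 2), eLpNorm (w τ) (ENNReal.ofReal (p : ℝ)) volume ≤ M := by
    intro τ hτ
    rw [← hpr, hMeq]
    exact eLpNorm_lerayBackward_shift_le_Lp (p : ℝ≥0∞) V hS1 hτ.1.le hτ.2.le
  have hdiv : ∀ τ ∈ Ioo (0 : ℝ) (1 / 2), IsWeaklyDivFree (w τ) := fun τ hτ =>
    isWeaklyDivFree_shift hT hv hV.1 hq hdev ⟨hτ.1, hτ.2.trans hS1⟩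
  have hweak : ∀ χ : ℝ → ℝ³ → ℝ³, IsSpaceTimeTestOn (slab ℝ³ (Ioo 0 (1 / 2)) isOpen_Ioo) χ →
      (∀ t, VectorCalculus.IsDivFree (χ t)) →
      ∫ ζ in Ioo 0 (1 / 2) ×ˢ (univ : Set ℝ³), veryWeakIntegrand 1 w χ ζ = 0 := fun χ hχ hdivχ =>
    integral_veryWeakIntegrand_shift_eq_zero hT hv hp2.le hV hVm hq hdev hS hS1 hχ hdivχ
  exact VeryWeakLqMild.isMildNSSolutionBetween_of_veryWeak one_pos hr2 hum huc huM hdiv hweak hs hst ht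

/-- **A classical representative of the blow-up limit on a final interval, `3 < p < ∞`.** Under
the hypotheses of Theorem 1.5 in normal form with `V̄ ∈ L^p` strongly measurable, `3 < p < ∞`,
there are `a < b ≤ 0` and a classical solution `(W, Π)` of Navier–Stokes (`ν = 1`, `f = 0`) on
`(a, b)` with `W(t) = u_V(t)` a.e. for every `t ∈ (a, b)`: the shifted limit is mild between all
times of `(0, ½)` (`isMildNSSolutionBetween_shift`), hence classical after `s₀ = ¼` on some interval
(`LpMildKato.exists_classical_representative`, Kato's `L^p` theory), and translating back.
[cite: Chae2007, proof of Thm 1.5 (arXiv p. 8); Kato1984, Thm. 1] -/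
theorem exists_classical_representative_lerayBackward_gt_three (hT : 0 < T)
    (hv : IsClassicalNSSolutionOn (Ioo 0 T) 1 0 v π) (hp3 : 3 < p) (hV : MemLp V (p : ℝ≥0∞) volume)
    (hVm : StronglyMeasurable V) (hq : 2 ≤ q)
    (hdev : ∀ R : ℝ, 0 < R → Tendsto (chaeLocalDeviation T z q R v V) (𝓝[<] T) (𝓝 0)) :
    ∃ (a b : ℝ) (W : ℝ → ℝ³ → ℝ³) (Pcl : ℝ → ℝ³ → ℝ), a < b ∧ b ≤ 0 ∧
      IsClassicalNSSolutionOn (Ioo a b) 1 0 W Pcl ∧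
      ∀ t ∈ Ioo a b, W t =ᵐ[volume] lerayBackward (1 / 2) 0 V t := by
  set w : ℝ → ℝ³ → ℝ³ := fun σ => lerayBackward (1 / 2) 0 V (σ - 1) with hw
  have hS1 : (1 / 2 : ℝ) < 1 := by norm_num
  have hp2 : 2 < p := lt_trans (by norm_num) hp3
  have hp₃ : (3 : ℝ≥0∞) < (p : ℝ≥0∞) := by exact_mod_cast hp3
  have hptop : (p : ℝ≥0∞) < ⊤ := ENNReal.coe_lt_top
  have hsm : StronglyMeasurable (uncurry w) := stronglyMeasurable_uncurry_lerayBackward_shift hVm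
  set M : ℝ≥0 := (ENNReal.ofReal (Real.sqrt (1 - 1 / 2))⁻¹ * eLpNorm V p volume).toNNReal with hM
  have hMeq : (M : ℝ≥0∞) = ENNReal.ofReal (Real.sqrt (1 - 1 / 2))⁻¹ * eLpNorm V p volume :=
    ENNReal.coe_toNNReal (ENNReal.mul_ne_top ENNReal.ofReal_ne_top hV.2.ne)
  have huM : ∀ τ ∈ Ioo (0 : ℝ) (1 / 2), eLpNorm (w τ) (p : ℝ≥0∞) volume ≤ M := by
    intro τ hτ
    rw [hMeq]
    exact eLpNorm_lerayBackward_shift_le_Lp (p : ℝ≥0∞) V hS1 hτ.1.le hτ.2.le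
  have hdiv : ∀ τ ∈ Ioo (0 : ℝ) (1 / 2), IsWeaklyDivFree (w τ) := fun τ hτ =>
    isWeaklyDivFree_shift hT hv hV.1 hq hdev ⟨hτ.1, hτ.2.trans hS1⟩
  have hmild : ∀ ⦃s t : ℝ⦄, 0 < s → s ≤ t → t < 1 / 2 → IsMildNSSolutionBetween 1 0 w s t :=
    fun s t hs hst ht => isMildNSSolutionBetween_shift hT hv hp2 hV hVm hq hdev hs hst ht
  have hs₀ : (1 / 4 : ℝ) ∈ Ioo (0 : ℝ) (1 / 2) := ⟨by norm_num, by norm_num⟩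
  obtain ⟨a, b, W, Pcl, hs₀a, hab, hbS, hW, hae⟩ :=
    LpMildKato.exists_classical_representative hp₃ hptop hsm huM hdiv hmild hs₀
  -- translate back by `-1`
  have h1 := hW.comp_add_right 1
  have hset : (fun t : ℝ => t + 1) ⁻¹' Ioo a b = Ioo (a - 1) (b - 1) := by
    ext t
    simp only [mem_preimage, mem_Ioo]
    constructor
    · rintro ⟨h1, h2⟩; exact ⟨by linarith, by linarith⟩
    · rintro ⟨h1, h2⟩; exact ⟨by linarith, by linarith⟩
  rw [hset] at h1
  have hf : (fun t : ℝ => (0 : ℝ → ℝ³ → ℝ³) (t + 1)) = 0 := by funext t; rfl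
  rw [hf] at h1
  refine ⟨a - 1, b - 1, fun t => W (t + 1), fun t => Pcl (t + 1), by linarith, by linarith, h1,
    fun t ht => ?_⟩
  have hσ : t + 1 ∈ Ioo a b := ⟨by linarith [ht.1], by linarith [ht.2]⟩
  have h := hae (t + 1) hσ
  have e2 : w (t + 1) = lerayBackward (1 / 2) 0 V t := by
    simp only [hw]; congr 1; ring
  rw [e2] at h
  exact h

end Chain

/-! ### `V̄ = 0` for all `3 ≤ p < ∞`, and the assembly from `h₂` alone -/

section Assembly

variable {T : ℝ} {q : ℝ≥0} {v : ℝ → ℝ³ → ℝ³} {π : ℝ → ℝ³ → ℝ}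

/-- **Chae 2007, Theorem 1.5, first conclusion for `3 < p < ∞`, proved**: let `(v, π)` be a
classical solution of Navier–Stokes (`ν = 1`, `f = 0`) on `ℝ³ × (0, T)`, `V̄ ∈ L^p(ℝ³)`,
`3 < p < ∞`, `q ≥ 2`, and suppose Chae's deviation tends to `0` as `t ↑ T` for every `R > 0`. Then
`V̄ = 0` a.e. (a strongly measurable representative; the classical representative of the blow-up
limit on a final interval, `exists_classical_representative_lerayBackward_gt_three`; the endgame
`profile_ae_eq_zero_of_classical_representative'` with Tsai's theorem). In print: "`V̄ ∈ L^p` is a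
weak solution of the Leray system … by [Tsai] `V̄ = 0`" (arXiv p. 8). [cite: Chae2007, proof of Thm 1.5 (arXiv p. 8); Tsai1998, Thm 1] -/
theorem chae2007_profile_ae_eq_zero_gt_three (hT : 0 < T)
    (hv : IsClassicalNSSolutionOn (Ioo 0 T) 1 0 v π) (z : ℝ³) {p : ℝ≥0} (hp3 : 3 < p) {V : ℝ³ → ℝ³}
    (hV : MemLp V (p : ℝ≥0∞) volume) (hq2 : 2 ≤ q)
    (hall : ∀ R : ℝ, 0 < R → Tendsto (chaeLocalDeviation T z q R v V) (𝓝[<] T) (𝓝 0)) :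
    V =ᵐ[volume] 0 := by
  set V' : ℝ³ → ℝ³ := hV.1.mk V with hV'def
  have hVV' : V =ᵐ[volume] V' := hV.1.ae_eq_mk
  have hV'm : StronglyMeasurable V' := hV.1.stronglyMeasurable_mk
  have hV' : MemLp V' (p : ℝ≥0∞) volume := hV.ae_eq hVV'
  have hall' : ∀ R : ℝ, 0 < R → Tendsto (chaeLocalDeviation T z q R v V') (𝓝[<] T) (𝓝 0) := by
    intro R hR
    refine (hall R hR).congr fun t => ?_
    exact chaeLocalDeviation_congr_ae hVV' t
  obtain ⟨a, b, W, Pcl, hab, hb, hW, hae⟩ :=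
    exists_classical_representative_lerayBackward_gt_three hT hv hp3 hV' hV'm hq2 hall'
  have hp3' : (3 : ℝ≥0∞) ≤ (p : ℝ≥0∞) := by exact_mod_cast hp3.le
  have h0 : V' =ᵐ[volume] 0 :=
    profile_ae_eq_zero_of_classical_representative' hp3' ENNReal.coe_lt_top hV' hab hb one_pos hW hae
  exact hVV'.trans h0

/-- **Chae 2007, Theorem 1.5, first conclusion `V̄ = 0`, proved for all `3 ≤ p < ∞`**
(`chae2007_profile_ae_eq_zero_three` for `p = 3`, Nečas–Růžička–Šverák;
`chae2007_profile_ae_eq_zero_gt_three` for `p > 3`, Tsai). [cite: Chae2007, Thm 1.5 (first conclusion) and its proof (arXiv p. 8)] -/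
theorem chae2007_profile_ae_eq_zero (hT : 0 < T) {p : ℝ≥0} (hp : 3 ≤ p)
    (hv : IsClassicalNSSolutionOn (Ioo 0 T) 1 0 v π) (z : ℝ³) {V : ℝ³ → ℝ³}
    (hV : MemLp V (p : ℝ≥0∞) volume) (hq2 : 2 ≤ q)
    (hall : ∀ R : ℝ, 0 < R → Tendsto (chaeLocalDeviation T z q R v V) (𝓝[<] T) (𝓝 0)) :
    V =ᵐ[volume] 0 := by
  rcases hp.eq_or_lt with h3 | h3
  · have hV3 : MemLp V 3 volume := by
      have : ((p : ℝ≥0) : ℝ≥0∞) = 3 := by rw [← h3]; norm_num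
      rwa [this] at hV
    exact chae2007_profile_ae_eq_zero_three hT hv z hV3 hq2 hall
  · exact chae2007_profile_ae_eq_zero_gt_three hT hv z h3 hV hq2 hall

/-- **Chae 2007, Theorem 1.5, from a suitable representative up to the blow-up time alone.**
The named fact `chae2007_asymptoticallySelfSimilar_local` follows from

* `h₂` — **a suitable representative up to the final time**: for the classical solution
  `v ∈ C([0,T); L^p)` and every `z`, some pair `(u, P)` of Albritton–Barker's class in a parabolic
  ball `Q((T, z), ρ)`, `ρ² ≤ T`, with `u = v` a.e. there (local Leray theory up to the blow-up time:
  cf. the tree's facts `localLeraySolution_exists_of_memE2`, `local_leray_weak_strong_uniqueness`).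

The profile conclusion `V̄ = 0` is now a theorem for every `3 ≤ p < ∞` (`chae2007_profile_ae_eq_zero`);
the Hölder conclusion then follows as in the seventh companion: the deviation from the zero profile
tends to `0` for every `R`, the representative of `h₂` inherits the scaled `L^∞_t L^q_x` smallness
(`exists_ae_eLpNorm_le_of_tendsto_chaeLocalDeviation_zero`), `C + D` is small at one scale
(`exists_cknC_add_cknD_lt_of_ae_eLpNorm_small_of_two_le`, every `q ≥ 2`), and the ε-regularity
endgame `chae_exists_eps_holder_of_suitableInBall` gives the Hölder conclusion.
[cite: Chae2007, Thm 1.5 and its proof (arXiv pp. 7–8)] -/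
theorem chae2007_asymptoticallySelfSimilar_local_of_suitableRepresentative
    (h₂ : ∀ ⦃T : ℝ⦄, 0 < T → ∀ ⦃p : ℝ≥0⦄, 3 ≤ p → ∀ ⦃v : ℝ → ℝ³ → ℝ³⦄ ⦃π : ℝ → ℝ³ → ℝ⦄,
      IsClassicalNSSolutionOn (Ioo 0 T) 1 0 v π → ContinuousInLpOn (Ico 0 T) p v →
      ∀ z : ℝ³, ∃ ρ : ℝ, 0 < ρ ∧ ρ ^ 2 ≤ T ∧ ∃ (u : ℝ → ℝ³ → ℝ³) (P : ℝ → ℝ³ → ℝ),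
        IsSuitableWeakSolutionInBall ρ (T, z) u P ∧
        uncurry u =ᵐ[volume.restrict (parabolicCylinder ρ (T, z))] uncurry v) :
    chae2007_asymptoticallySelfSimilar_local := by
  intro T hT p hp v π hv hvc z V hV q hq
  obtain ⟨hq2, hall⟩ := forall_tendsto_chaeLocalDeviation_of_hyp hq
  have hV0 : V =ᵐ[volume] 0 := chae2007_profile_ae_eq_zero hT hp hv z hV hq2 hall
  refine ⟨hV0, ?_⟩
  have hall0 : ∀ R : ℝ, 0 < R → Tendsto (chaeLocalDeviation T z q R v 0) (𝓝[<] T) (𝓝 0) := by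
    intro R hR
    refine (hall R hR).congr fun t => ?_
    exact chaeLocalDeviation_congr_ae hV0 t
  obtain ⟨ε₀, hε₀, H⟩ := chae_exists_eps_holder_of_suitableInBall hv z
  obtain ⟨ρ, hρ, hρT, u, P, hIB, huv⟩ := h₂ hT hp hv hvc z
  have hS : ∀ η : ℝ, 0 < η → ∃ r₁ : ℝ, 0 < r₁ ∧ r₁ ≤ ρ ∧ ∀ r : ℝ, 0 < r → r ≤ r₁ →
      ∀ᵐ t ∂(volume.restrict (Ioo ((T, z).1 - r ^ 2) (T, z).1)),
        eLpNorm (u t) (q : ℝ≥0∞) (volume.restrict (ball (T, z).2 r)) *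
          ENNReal.ofReal (r ^ (((q : ℝ) - 3) / q)) ≤ ENNReal.ofReal η := fun η hη =>
    exists_ae_eLpNorm_le_of_tendsto_chaeLocalDeviation_zero hρ (hall0 1 one_pos) huv hη
  obtain ⟨r₀, hr₀, hr₀ρ, hsmall⟩ :=
    exists_cknC_add_cknD_lt_of_ae_eLpNorm_small_of_two_le hIB hq2 hS hε₀
  exact H r₀ hr₀ (by nlinarith) u P (hIB.of_le_radius hr₀ hr₀ρ)
    (ae_restrict_of_ae_restrict_of_subset (parabolicCylinder_mono hr₀.le hr₀ρ (T, z)) huv) hsmall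

end Assembly

end Literature.Analysis.FluidPDE

end
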